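import Mathlib
import Summits.HubbardSuperconductivity.HubbardSuperconductivity.Theses.BalabanIR
import Literature.MathematicalPhysics.QuantumLattice.FinDimSpectrum

/-!
# Sketch — crux-ideate stmt-HubbardSuperconductivity-2083 (`BalabanIR.BirEveryGroundState`), ideator 3, round 1

First lemmas of the three idea cards, stated as `Prop`s over existing declarations (they must
ELABORATE; they are not proved here).  All are finite-dimensional linear algebra; the Hubbard
instance is obtained by taking `T := hubbardTorus 2 L 1 0` (hopping), `D :=` the on-site
interaction (so that `hubbardTorus 2 L 1 U = T + U • D`, cf. the affine-in-`U` structure used by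
`Literature/Analysis/Matrix/HermitianPencil.lean`), `Y := (pairField dWaveFormFactor L)ᴴ *
pairField dWaveFormFactor L`, `K :=` the sector ground eigenspace of the crux.
-/

set_option linter.dupNamespace false

namespace Summit.HubbardSuperconductivity.HubbardSuperconductivity.Cruxes.BirEveryGroundState.Sketch

open Matrix Literature.MathematicalPhysics.QuantumLattice

/-- Card `commutant-schur-pair-invariance`, FIRST LEMMA (commutant Schur).
`T D Y` Hermitian matrices, `K` a subspace invariant under the commutant
`𝔠 = {X | XT = TX ∧ XD = DX}` (automatic for an eigenspace of `T + U•D`).  If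
(i') every `X ∈ 𝔠` commutes with `Y` IN MATRIX ELEMENTS BETWEEN VECTORS OF `K`
    (`⟨w, (XY - YX) v⟩ = 0`, i.e. `P_K [X,Y] P_K = 0` — "all symmetries, known or hidden, preserve
    the d-wave pair structure factor on the ground space"), and
(ii) `K` is Schur-irreducible for `𝔠` (an operator preserving `K` whose action on `K` commutes
    with that of every `X ∈ 𝔠` is a scalar on `K`),
then the compression of `Y` to `K` is a scalar: every unit vector of `K` has the same `⟨Y⟩`
(= the average).  [Schur's lemma for the *-algebra `P_K 𝔠 P_K`; folklore] -/
def CommutantSchur : Prop :=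
  ∀ (n : Type) [Fintype n] [DecidableEq n] (T D Y : Matrix n n ℂ) (K : Submodule ℂ (n → ℂ)),
    T.IsHermitian → D.IsHermitian → Y.IsHermitian →
    (∀ X : Matrix n n ℂ, X * T = T * X → X * D = D * X → ∀ v ∈ K, X *ᵥ v ∈ K) →
    (∀ X : Matrix n n ℂ, X * T = T * X → X * D = D * X →
        ∀ v ∈ K, ∀ w ∈ K, star w ⬝ᵥ (X * Y - Y * X) *ᵥ v = 0) →
    (∀ Z : Matrix n n ℂ, (∀ v ∈ K, Z *ᵥ v ∈ K) →
        (∀ X : Matrix n n ℂ, X * T = T * X → X * D = D * X → ∀ v ∈ K, (Z * X - X * Z) *ᵥ v = 0) →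
        ∃ c : ℂ, ∀ v ∈ K, Z *ᵥ v = c • v) →
    ∃ c : ℂ, ∀ v ∈ K, ∀ w ∈ K, star w ⬝ᵥ Y *ᵥ v = c * (star w ⬝ᵥ v)

/-- Shared bookkeeping of all three cards (ALL-OR-NOTHING in the coupling): two Hermitian affine
pencils `T₁ + U•D₁`, `T₂ + U•D₂` (think: two symmetry blocks of the sector Hamiltonian) which share
an eigenvalue at infinitely many couplings `U` in a bounded interval share an eigenvalue at EVERY
real coupling (the resultant `Res_x(char₁, char₂) ∈ ℂ[U]` has infinitely many roots, hence vanishes).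
So a permanent inter-block ground degeneracy on a sub-window is a GLOBAL polynomial identity of
level `L`, visible at any convenient `U` (e.g. `U → 0⁺` perturbatively).  [folklore; Mathlib has
`Polynomial.resultant`] -/
def SharedEigenvalueAllOrNothing : Prop :=
  ∀ (n m : Type) [Fintype n] [DecidableEq n] [Fintype m] [DecidableEq m]
    (T₁ D₁ : Matrix n n ℂ) (T₂ D₂ : Matrix m m ℂ) (a b : ℝ),
    T₁.IsHermitian → D₁.IsHermitian → T₂.IsHermitian → D₂.IsHermitian →
    {U : ℝ | U ∈ Set.Icc a b ∧ ∃ x : ℂ, x ∈ spectrum ℂ (T₁ + (U : ℂ) • D₁) ∧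
        x ∈ spectrum ℂ (T₂ + (U : ℂ) • D₂)}.Infinite →
    ∀ U : ℝ, ∃ x : ℂ, x ∈ spectrum ℂ (T₁ + (U : ℂ) • D₁) ∧ x ∈ spectrum ℂ (T₂ + (U : ℂ) • D₂)

/-- Shared bookkeeping (COUNTABLE CHOICE OF THE COUPLING): the crux's conclusion needs ONE `U`; if
for all large even `L` the set of "bad" couplings in the window is countable (e.g. finite: no bad
INTERVAL), a good `U` exists.  Pure set theory over `ℝ`: a countable union of countable subsets of
a nondegenerate interval misses a point. [folklore] -/
def CountableBadSetsMissAPoint : Prop :=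
  ∀ (U₁ U₂ : ℝ), U₁ < U₂ → ∀ (B : ℕ → Set ℝ), (∀ L, (B L).Countable) →
    ∃ U ∈ Set.Ioo U₁ U₂, ∀ L, U ∉ B L

/-- Card `exponential-headcount-entropy-vs-tail`, FIRST LEMMA (variance head-count; `exp`-free
version).  For Hermitian `Y` and a nonzero subspace `K` with orthogonal projection `P`
(`projMatrix`, `tr P = dim K =: m`), tracial mean `ȳ = tr(P Y)/m`: EVERY unit vector `ψ ∈ K` has
`⟨ψ, Y ψ⟩ ≥ ȳ - √(tr(P Y Y) - m ȳ²)`.  Proof idea: the eigenvalues `yᵢ` of `P Y P|_K` satisfy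
`Σ (yᵢ - ȳ)² = tr (PYP)² - m ȳ² ≤ tr(P Y²) - m ȳ²` because `P Y (1 - P) Y P ≥ 0`.  So the spread of
`⟨Y⟩` over ground states is bounded by `√m ×` (tracial standard deviation of `Y`), a GROUND-STATE
AVERAGE quantity. [folklore; cf. Berezin–Lieb / Jensen trace inequality] -/
def VarianceHeadCount : Prop :=
  ∀ (n : Type) [Fintype n] [DecidableEq n] (Y : Matrix n n ℂ) (K : Submodule ℂ (n → ℂ)),
    Y.IsHermitian → K ≠ ⊥ →
    let P : Matrix n n ℂ := projMatrix (K.map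
      ((WithLp.linearEquiv 2 ℂ (n → ℂ)).symm : (n → ℂ) →ₗ[ℂ] EuclideanSpace ℂ n))
    let m : ℝ := P.trace.re
    let ybar : ℝ := (P * Y).trace.re / m
    ∀ ψ ∈ K, star ψ ⬝ᵥ ψ = 1 →
      ybar - Real.sqrt ((P * Y * Y).trace.re - m * ybar ^ 2) ≤ (star ψ ⬝ᵥ Y *ᵥ ψ).re

/-- Card `exponential-headcount-entropy-vs-tail`, MAIN INEQUALITY (exponential head-count, the
line's load-bearing form; Jensen for the spectral measure of `Y` in each vector of an eigenbasis of
`P Y P`):  `min_{ψ ∈ K unit} ⟨ψ,Yψ⟩ ≥ -(1/t) · log Re tr (P · exp(-t Y))` for every `t > 0`; with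
`tr(P e^{-tY}) = m · e^{-t ȳ} · ω̄(e^{-t(Y-ȳ)})` this reads
`y_min ≥ ȳ - [log m + Λ(t)]/t`, `Λ(t) = log ω̄(e^{-t(Y - ȳ)})` the lower cumulant generating function
of `Y` in the ground-state AVERAGE `ω̄ = tr(P ·)/m`: EVERY ground state inherits the average order up
to (log-degeneracy + lower-tail cumulant)/t. [folklore: Peierls–Bogoliubov / Berezin–Lieb] -/
def ExponentialHeadCount : Prop :=
  ∀ (n : Type) [Fintype n] [DecidableEq n] (Y : Matrix n n ℂ) (K : Submodule ℂ (n → ℂ)) (t : ℝ),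
    Y.IsHermitian → K ≠ ⊥ → 0 < t →
    let P : Matrix n n ℂ := projMatrix (K.map
      ((WithLp.linearEquiv 2 ℂ (n → ℂ)).symm : (n → ℂ) →ₗ[ℂ] EuclideanSpace ℂ n))
    ∀ ψ ∈ K, star ψ ⬝ᵥ ψ = 1 →
      -(1 / t) * Real.log (P * NormedSpace.exp (-(t : ℂ) • Y)).trace.re ≤ (star ψ ⬝ᵥ Y *ᵥ ψ).re

/-- Card `kappa-chord-transfer`, FIRST LEMMA (the chord inequality; provable now).
`H` Hermitian, `Y` Hermitian (the intended `Y = L⁻⁴ Δ_dᴴΔ_d ≥ 0`), `S` an `H`- and `Y`-invariant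
sector, `κ > 0`.  Then EVERY normalised ground state `ψ` of `H` in `S` (energy `= minEnergyOn H S`)
has `⟨ψ, Y ψ⟩ ≥ (minEnergyOn (H + κ•Y) S - minEnergyOn H S)/κ`:  the concave function
`κ ↦ E(κ) = minEnergyOn (H + κY) S` lies below its chords, and its right-derivative at `0` is
`min ⟨Y⟩` over the ground space — here one only needs the one-line variational step
`E(κ) ≤ ⟨ψ,(H + κY)ψ⟩ = E(0) + κ⟨ψ,Yψ⟩`. [folklore] -/
def ChordLemma : Prop :=
  ∀ (n : Type) [Fintype n] [DecidableEq n] (H Y : Matrix n n ℂ) (S : Submodule ℂ (n → ℂ)) (κ : ℝ),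
    H.IsHermitian → Y.IsHermitian → 0 < κ →
    ∀ ψ ∈ S, star ψ ⬝ᵥ ψ = 1 → (star ψ ⬝ᵥ H *ᵥ ψ).re = H.minEnergyOn S →
      ((H + (κ : ℂ) • Y).minEnergyOn S - H.minEnergyOn S) / κ ≤ (star ψ ⬝ᵥ Y *ᵥ ψ).re

/-- Card `kappa-chord-transfer`, the TRANSFERRED STATEMENT `C⁺` at one coupling (Hubbard instance,
typed over the crux's own objects): a pair PENALTY of fixed mesoscopic strength `κ` on the
`L⁻⁴`-normalised `d`-wave structure factor raises the sector ground energy by an `L`-independent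
amount `κ a`.  By `ChordLemma` this implies `L⁻⁴⟨ψ, Δ_dᴴΔ_d ψ⟩ ≥ a` for EVERY sector ground state at
every large even `L`, i.e. the conclusion of `BirEveryGroundState` at this `U` (with `HasLongRangeOrder`
bookkeeping as in the route's Assembly).  The `U(1)` phase-twist obstruction caps `κ a` by the
superflow cost `~2π²ρ_s |ψ|²` (an `O(1)` energy) but does not kill the statement. -/
def KappaChordAt (U δ : ℝ) : Prop :=
  ∃ κ a : ℝ, 0 < κ ∧ 0 < a ∧ ∃ L₀ : ℕ, ∀ (L : ℕ) [NeZero L], L₀ ≤ L → Even L →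
    let N : ℕ := 2 * ⌊(1 - δ) * (L : ℝ) ^ 2 / 2⌋₊
    let H := hubbardTorus 2 L 1 U
    let S := szSector (Λ := FermionTorus 2 L) N 0
    let Yd : Matrix _ _ ℂ := ((1 : ℂ) / (L : ℂ) ^ 4) •
      (Matrix.conjTranspose (pairField dWaveFormFactor L) * pairField dWaveFormFactor L)
    κ * a ≤ (H + (κ : ℂ) • Yd).minEnergyOn S - H.minEnergyOn S

/-- The transfer in the crux's own quantifier shell: `C⁺ :=` window-average LRO ⇒ some `U` in the
window satisfies `KappaChordAt U δ`.  `C⁺ ∧ ChordLemma ⇒ BirEveryGroundState` (two lines + the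
route's liminf bookkeeping). -/
def KappaChordTransfer : Prop :=
  ∀ (δ U₁ U₂ c : ℝ), δ ∈ Set.Ioo (0:ℝ) (1/2) → 0 < U₁ → U₁ < U₂ → 0 < c →
    (∀ U ∈ Set.Ioo U₁ U₂, ∃ L₀ : ℕ, ∀ (L : ℕ) [NeZero L], L₀ ≤ L → Even L →
      let N : ℕ := 2 * ⌊(1 - δ) * (L : ℝ) ^ 2 / 2⌋₊
      let H := hubbardTorus 2 L 1 U
      let S := szSector (Λ := FermionTorus 2 L) N 0
      let E₀ := S ⊓ Module.End.eigenspace (Matrix.toLin' H) ((H.minEnergyOn S : ℝ) : ℂ)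
      let P := projMatrix (E₀.map (Fock.toEuclidean (ι := Orb (FermionTorus 2 L)) :
        Fock (Orb (FermionTorus 2 L)) →ₗ[ℂ] EuclideanSpace ℂ (Finset (Orb (FermionTorus 2 L)))))
      c * (L : ℝ) ^ 4 * P.trace.re ≤
        (P * (Matrix.conjTranspose (pairField dWaveFormFactor L) * pairField dWaveFormFactor L)).trace.re) →
    ∃ U ∈ Set.Ioo U₁ U₂, KappaChordAt U δ

end Summit.HubbardSuperconductivity.HubbardSuperconductivity.Cruxes.BirEveryGroundState.Sketch
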